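import Literature.Topology.FourManifolds.SliceKnots
import HarnessLib

/-!
# Fox–Milnor facts of `SliceKnots.lean`: reductions (sibling proof file)

Sibling proof file of `Literature/Topology/FourManifolds/SliceKnots.lean` for its two
**Fox–Milnor** named facts (inventory id `spc4.S26`; D-0014 named facts `def … : Prop`):

* `Literature.Topology.FourManifolds.exists_eq_mul_invert_of_isSmoothlySlice` (smooth),
* `Literature.Topology.FourManifolds.exists_eq_mul_invert_of_isTopologicallySlice` (topological).

Both formalise R. H. Fox, J. W. Milnor, *Singularities of 2-spheres in 4-space and
cobordism of knots*, Osaka J. Math. **3** (1966), 257–267, Theorem 2: an Alexander polynomial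
of a slice (= null-cobordant) knot has the form `± tᵏ · f(t) · f(t⁻¹)`; in the tree's
normalisation `Δ = u * f * LaurentPolynomial.invert f` with `u` a unit of `ℤ[t, t⁻¹]`, for every
`Δ` with `Knot.IsAlexanderPolynomial K Δ` (a generator of the order ideal of the Alexander module
of `π₁(S³ ∖ K)`, `KnotGroup.lean`/`AlexanderModule.lean`).

A third, primed declaration `exists_eq_mul_invert_of_isSmoothlySlice'` used to accompany them:
before the D-0014 sorry-sweep it was the *theorem* deducing the smooth condition from the
topological one, and the sweep demoted it to a named fact whose statement was *verbatim* that of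
`exists_eq_mul_invert_of_isSmoothlySlice` (this file proved the `Iff.rfl` between them).  Under
the D-0026 review of 2026-08-15 that duplicate is merged back into
`exists_eq_mul_invert_of_isSmoothlySlice`: this file no longer mentions it, and its content — the
one-line deduction — is `exists_eq_mul_invert_of_isTopologicallySlice.isSmoothlySlice` below.

## What is proved here (no named facts are introduced)

* `exists_eq_mul_invert_of_isTopologicallySlice.isSmoothlySlice`: the smooth fact follows from
  the topological one together with `Knot.IsSmoothlySlice.isTopologicallySlice`
  (`SliceRibbon.lean`, smoothly slice ⇒ topologically slice) — the one-line proof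
  `exists_eq_mul_invert_of_isTopologicallySlice K hK.isTopologicallySlice hΔ` that the sweep
  preserved as a comment, made relative to the two named facts it used.
* `foxMilnor_facts_of_isTopologicallySlice`: hence both facts hold as soon as the topological
  fact and `Knot.IsSmoothlySlice.isTopologicallySlice` do.
* §FoxMilnor (appended 2026-08-15, below): the algebraic step `det(t θ − θᵀ) = u · f · f(t⁻¹)`
  for metabolic / algebraically slice integer matrices, fully proved.

## What is *not* proved here, and why

No discharge `…_holds` of either fact: for the tree's genuine `π₁`-based Alexander
polynomial this is the full Fox–Milnor theorem (Alexander duality `H₁(S³ ∖ K) ≅ ℤ`, the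
Alexander module of the slice-disc complement and Milnor duality in its infinite cyclic cover,
or — textbook line — a Seifert surface presenting the Alexander module by `V − tVᵀ` with `V`
metabolic for a slice knot), none of which is available over Mathlib at present; the sibling
file `SliceKnotsFoxMilnorProofs.lean` reduces both facts to exactly that geometric half
(`exists_eq_mul_invert_of_isTopologicallySlice_of_presentation`,
`exists_eq_mul_invert_of_isSmoothlySlice_of_presentation`).  Once
`exists_eq_mul_invert_of_isTopologicallySlice_holds` and
`Knot.IsSmoothlySlice.isTopologicallySlice_holds` exist, the smooth fact is discharged by
`exists_eq_mul_invert_of_isTopologicallySlice_holds.isSmoothlySlice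
Knot.IsSmoothlySlice.isTopologicallySlice_holds`.

## References

* R. H. Fox, J. W. Milnor, *Singularities of 2-spheres in 4-space and cobordism of knots*,
  Osaka J. Math. 3 (1966), 257–267, §2, Thm. 2 (p. 262; footnote 5: `A₁ ≐ A₂` means
  `A₁(t) = ±tⁿ A₂(t)`), proof pp. 262–263 via Milnor's duality for Reidemeister torsion
  [FoxMilnor1966; full record FoxMilnorOJM1966, Zbl 0146.45501].
* M. H. Freedman, F. Quinn, *Topology of 4-manifolds* (1990), §9.3 (smooth ⇒ flat slice discs),
  11.7 [FreedmanQuinn1990].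
-/

open scoped LaurentPolynomial

noncomputable section

namespace Literature.Topology.FourManifolds

/-- The smooth Fox–Milnor condition follows from the topological one (`h`) because smoothly slice
knots are topologically slice (`Knot.IsSmoothlySlice.isTopologicallySlice`, hypothesis `hst`: a
tubular neighbourhood of a smooth neat slice disc is a product neighbourhood, Freedman–Quinn
(1990), §9.3).  Fox–Milnor (1966), Thm. 2, whose printed proof uses only a (PL) locally flat
slice disc. [cite: FoxMilnor1966, §2 Thm. 2, p. 262] -/
theorem exists_eq_mul_invert_of_isTopologicallySlice.isSmoothlySlice
    (h : exists_eq_mul_invert_of_isTopologicallySlice)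
    (hst : Knot.IsSmoothlySlice.isTopologicallySlice) :
    exists_eq_mul_invert_of_isSmoothlySlice :=
  fun K hK _ hΔ ↦ h K (hst hK) hΔ

/-- Both Fox–Milnor facts of `SliceKnots.lean` hold as soon as the topological one (`h`) and
`Knot.IsSmoothlySlice.isTopologicallySlice` (`hst`) do. [folklore] -/
theorem foxMilnor_facts_of_isTopologicallySlice
    (h : exists_eq_mul_invert_of_isTopologicallySlice)
    (hst : Knot.IsSmoothlySlice.isTopologicallySlice) :
    exists_eq_mul_invert_of_isSmoothlySlice ∧ exists_eq_mul_invert_of_isTopologicallySlice :=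
  ⟨h.isSmoothlySlice hst, h⟩

/-!
## Appended 2026-08-15: the algebraic step of the Fox–Milnor argument (fully proved)

The printed proofs of Fox–Milnor's Theorem 2 in the smooth category (textbook form: Kauffman,
*On Knots* (1988), Ch. VIII, Thm. 8.2 and Thm. 8.3 (ii); Fox–Milnor's own proof, pp. 262–263,
goes through Milnor duality for Reidemeister torsion instead) run:

1. a slice disc `D ⊂ B⁴` and a Seifert surface `F ⊂ S³` of `K` cobound a compact `3`-manifold
   `M ⊂ B⁴` (relative transversality / obstruction theory);
2. by Poincaré–Lefschetz duality half of `H₁(F)` dies in `H₁(M)` and the Seifert pairing `θ`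
   vanishes on that half (Kauffman Thm. 8.2): in an adapted basis `θ = [[0, X], [Y, Z]]` with
   square blocks of equal size ("metabolic"; in an arbitrary basis: unimodularly congruent, up
   to reindexing, to such a matrix — "algebraically slice", Kauffman Def. 8.6);
3. `Δ_K ≐ det(t θ − θᵀ)` (Seifert-matrix presentation of the Alexander module);
4. `det(t θ − θᵀ) = u · f(t) · f(t⁻¹)` for such `θ`, `u` a unit of `ℤ[t, t⁻¹]`
   (Kauffman, proof of Thm. 8.3 (ii)).

Steps 1–3 need homology and duality of compact manifolds, Seifert surfaces and the
identification of the intrinsic Alexander ideal (`alexanderIdeal`, a Fitting ideal of `G'/G''`)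
with `det(t θ − θᵀ)`, none of which exists over Mathlib yet; the section below proves step 4 in
the shape of the conclusion of the facts (`∃ f u, _ = ↑u * f * LaurentPolynomial.invert f`):

* `FoxMilnor.det_fromBlocks_zero₁₁`: `det [[0, B], [C, D]] = sign(swap) · det B · det C` for
  square blocks of equal size (the permutation sign is left symbolic; it is a unit);
* `FoxMilnor.exists_det_metabolic_eq_mul_invert`: for integer square blocks `X Y Z` and
  `θ = [[0, X], [Y, Z]]` pushed to `ℤ[t, t⁻¹]`, `det(t θ − θᵀ) = u · f · f(t⁻¹)` with
  `f = det(t X − Yᵀ)` and `u = sign(swap) · (−t)^g`;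
* `FoxMilnor.exists_det_congr_metabolic_eq_mul_invert`: the same for any integer matrix `V`
  with `(Aᵀ V A).submatrix e e` metabolic for some `A` with `det A = ±1` and reindexing `e`;
* `FoxMilnor.exists_eq_mul_invert_unit_mul`, `FoxMilnor.exists_eq_mul_invert_invert`: the form
  `u · f · f(t⁻¹)` is stable under the two ambiguities of Alexander polynomials (units `±tᵏ`,
  `t ↦ t⁻¹`), so the Seifert-matrix convention in step 3 (`t θ − θᵀ` as in Lickorish 1997,
  Thm. 6.5; `t⁻¹ θ − t θᵀ` in Kauffman; `θᵀ − t θ` in Rolfsen) is immaterial, and the transpose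
  of a metabolic matrix is metabolic.

No definitions and no named facts are introduced (D-0026). Sources: L. H. Kauffman, *On Knots*,
Annals of Mathematics Studies 115, Princeton (1988), Ch. VIII, Thm. 8.2, Thm. 8.3, Def. 8.6
[Kauffman1988]; Fox–Milnor (1966), Thm. 2 [FoxMilnor1966, FoxMilnorOJM1966]. Mathlib:
`Matrix.fromBlocks`, `Matrix.det_fromBlocks_zero₁₂`, `Matrix.det_permute'`, `Matrix.det_smul`,
`Matrix.det_submatrix_equiv_self`, `AlgEquiv.map_det`, `LaurentPolynomial.invert`,
`LaurentPolynomial.isUnit_T`.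
-/

open Matrix LaurentPolynomial

namespace FoxMilnor

variable {m : Type*} [Fintype m] [DecidableEq m]

/-- Determinant of a `2 × 2` block matrix with vanishing upper-left block and square blocks of the
same size: `det [[0, B], [C, D]] = sign(σ) · det B · det C`, where `σ` is the block swap of the
columns (so `sign σ = (−1)^g` for `g × g` blocks; it is left symbolic here). Reduction to the block
lower-triangular case `Matrix.det_fromBlocks_zero₁₂` by `Matrix.det_permute'`. [folklore] -/
theorem det_fromBlocks_zero₁₁ {R : Type*} [CommRing R] (B C D : Matrix m m R) :
    (fromBlocks (0 : Matrix m m R) B C D).det =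
      Equiv.Perm.sign (Equiv.sumComm m m) * (B.det * C.det) := by
  have h : fromBlocks (0 : Matrix m m R) B C D =
      (fromBlocks B 0 D C).submatrix id (Equiv.sumComm m m) := by
    ext (i | i) (j | j) <;> rfl
  rw [h, det_permute', det_fromBlocks_zero₁₂]

/-- **Algebraic core of the Fox–Milnor condition** (Kauffman, *On Knots* (1988), Ch. VIII, proof
of Thm. 8.3 (ii); Fox–Milnor 1966, Thm. 2). If an integer square matrix is *metabolic*,
`θ = [[0, X], [Y, Z]]` with square blocks of equal size (the Seifert matrix of a slice knot in a
basis adapted to a half-rank subspace on which the Seifert pairing vanishes, Kauffman Thm. 8.2),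
then `det(t θ − θᵀ) = u · f(t) · f(t⁻¹)` in `ℤ[t, t⁻¹]` for `f = det(t X − Yᵀ)` and a unit
`u` (namely `sign(swap) · (−t)^g`): indeed `t θ − θᵀ = [[0, tX − Yᵀ], [tY − Xᵀ, tZ − Zᵀ]]` and
`(tY − Xᵀ)ᵀ = −t · (t⁻¹X − Yᵀ) = −t · f-matrix(t⁻¹)`. Here `f(t⁻¹)` is `LaurentPolynomial.invert f`
and `θ` is pushed to `ℤ[t, t⁻¹]` by `LaurentPolynomial.C`. This is the algebraic step of the proof
of Fox–Milnor 1966, Thm. 2 (`exists_eq_mul_invert_of_isSmoothlySlice`).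
[cite: Kauffman1988, Ch. VIII Thm. 8.3 (ii)] -/
theorem exists_det_metabolic_eq_mul_invert (X Y Z : Matrix m m ℤ) :
    ∃ (f : ℤ[T;T⁻¹]) (u : ℤ[T;T⁻¹]ˣ),
      ((T 1 : ℤ[T;T⁻¹]) • (fromBlocks (0 : Matrix m m ℤ) X Y Z).map (C : ℤ →+* ℤ[T;T⁻¹]) -
          ((fromBlocks (0 : Matrix m m ℤ) X Y Z).map (C : ℤ →+* ℤ[T;T⁻¹]))ᵀ).det =
        ↑u * f * LaurentPolynomial.invert f := by
  -- the four blocks of `t θ − θᵀ`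
  set P : Matrix m m ℤ[T;T⁻¹] := (T 1 : ℤ[T;T⁻¹]) • X.map C - (Y.map C)ᵀ with hP
  set Q : Matrix m m ℤ[T;T⁻¹] := (T 1 : ℤ[T;T⁻¹]) • Y.map C - (X.map C)ᵀ with hQ
  set S : Matrix m m ℤ[T;T⁻¹] := (T 1 : ℤ[T;T⁻¹]) • Z.map C - (Z.map C)ᵀ with hS
  have hM : (T 1 : ℤ[T;T⁻¹]) • (fromBlocks (0 : Matrix m m ℤ) X Y Z).map (C : ℤ →+* ℤ[T;T⁻¹]) -
      ((fromBlocks (0 : Matrix m m ℤ) X Y Z).map (C : ℤ →+* ℤ[T;T⁻¹]))ᵀ = fromBlocks 0 P Q S := by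
    ext (i | i) (j | j) <;> simp [P, Q, S, fromBlocks, Matrix.sub_apply, Matrix.smul_apply]
  -- the lower-left block is `−t` times the upper-right block with `t ↦ t⁻¹`, transposed
  have hT : (T 1 : ℤ[T;T⁻¹]) * T (-1) = 1 := by rw [← T_add]; simp
  have hQP : Qᵀ = (-T 1 : ℤ[T;T⁻¹]) • (LaurentPolynomial.invert.mapMatrix P) := by
    refine Matrix.ext fun i j ↦ ?_
    simp only [hP, hQ, transpose_apply, Matrix.sub_apply, Matrix.smul_apply, Matrix.map_apply,
      smul_eq_mul, AlgEquiv.mapMatrix_apply, map_sub, map_mul, invert_T, invert_C]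
    linear_combination (C (X i j)) * hT
  -- the unit
  have hu : IsUnit ((Equiv.Perm.sign (Equiv.sumComm m m) : ℤ[T;T⁻¹]) *
      (-T 1 : ℤ[T;T⁻¹]) ^ Fintype.card m) := by
    refine IsUnit.mul ?_ ((isUnit_T (R := ℤ) 1).neg.pow _)
    simpa using (Equiv.Perm.sign (Equiv.sumComm m m)).isUnit.map (Int.castRingHom ℤ[T;T⁻¹])
  refine ⟨P.det, hu.unit, ?_⟩
  rw [IsUnit.unit_spec, hM, det_fromBlocks_zero₁₁, ← det_transpose Q, hQP, det_smul,
    ← AlgEquiv.map_det]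
  ring

/-- The Fox–Milnor form `u · f · f(t⁻¹)` (`u` a unit of `ℤ[t, t⁻¹]`) is stable under multiplication
by units — the ambiguity `±tᵏ` of Alexander polynomials. [folklore] -/
theorem exists_eq_mul_invert_unit_mul {x v : ℤ[T;T⁻¹]} (hv : IsUnit v)
    (hx : ∃ (f : ℤ[T;T⁻¹]) (u : ℤ[T;T⁻¹]ˣ), x = ↑u * f * LaurentPolynomial.invert f) :
    ∃ (f : ℤ[T;T⁻¹]) (u : ℤ[T;T⁻¹]ˣ), v * x = ↑u * f * LaurentPolynomial.invert f := by
  obtain ⟨f, u, rfl⟩ := hx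
  exact ⟨f, hv.unit * u, by rw [Units.val_mul, IsUnit.unit_spec]; ring⟩

/-- The Fox–Milnor form `u · f · f(t⁻¹)` is stable under the involution `t ↦ t⁻¹`
(`LaurentPolynomial.invert`) — the second ambiguity of Alexander polynomials. [folklore] -/
theorem exists_eq_mul_invert_invert {x : ℤ[T;T⁻¹]}
    (hx : ∃ (f : ℤ[T;T⁻¹]) (u : ℤ[T;T⁻¹]ˣ), x = ↑u * f * LaurentPolynomial.invert f) :
    ∃ (f : ℤ[T;T⁻¹]) (u : ℤ[T;T⁻¹]ˣ),
      LaurentPolynomial.invert x = ↑u * f * LaurentPolynomial.invert f := by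
  obtain ⟨f, u, rfl⟩ := hx
  refine ⟨f, Units.map (LaurentPolynomial.invert : ℤ[T;T⁻¹] ≃ₐ[ℤ] ℤ[T;T⁻¹]) u, ?_⟩
  rw [map_mul, map_mul, involutive_invert f, Units.coe_map]
  simp only [MonoidHom.coe_coe]
  ring

/-- **Fox–Milnor form for algebraically slice Seifert matrices** (Kauffman, *On Knots* (1988),
Ch. VIII, Thm. 8.3 (ii) with Def. 8.6; Fox–Milnor 1966, Thm. 2). If an integer square matrix `V`
is unimodularly congruent (`Aᵀ V A`, `det A = ±1`) to a matrix which after reindexing the basis is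
metabolic, `[[0, X], [Y, Z]]` with square blocks of equal size, then
`det(t V − Vᵀ) = u · f(t) · f(t⁻¹)` for some `f ∈ ℤ[t, t⁻¹]` and a unit `u`. This is the form in
which step 4 of the Fox–Milnor argument is consumed: a Seifert matrix of a slice knot is of this
kind (Kauffman Thm. 8.2), in any basis of `H₁` of the Seifert surface. Reduction to
`exists_det_metabolic_eq_mul_invert`: `t(AᵀVA) − (AᵀVA)ᵀ = Aᵀ (tV − Vᵀ) A`, determinants are
invariant under reindexing and `det A` is a unit.
[cite: Kauffman1988, Ch. VIII Thm. 8.3 (ii) and Def. 8.6] -/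
theorem exists_det_congr_metabolic_eq_mul_invert {n : Type*} [Fintype n] [DecidableEq n]
    (V A : Matrix n n ℤ) (hA : IsUnit A.det) (e : m ⊕ m ≃ n) (X Y Z : Matrix m m ℤ)
    (hV : (Aᵀ * V * A).submatrix e e = fromBlocks 0 X Y Z) :
    ∃ (f : ℤ[T;T⁻¹]) (u : ℤ[T;T⁻¹]ˣ),
      ((T 1 : ℤ[T;T⁻¹]) • V.map (C : ℤ →+* ℤ[T;T⁻¹]) - (V.map (C : ℤ →+* ℤ[T;T⁻¹]))ᵀ).det =
        ↑u * f * LaurentPolynomial.invert f := by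
  obtain ⟨f, u, hu⟩ := exists_det_metabolic_eq_mul_invert X Y Z
  rw [← hV] at hu
  -- reindexing commutes with the (entrywise) operations and preserves the determinant
  have h1 : (T 1 : ℤ[T;T⁻¹]) • ((Aᵀ * V * A).submatrix e e).map (C : ℤ →+* ℤ[T;T⁻¹]) -
      (((Aᵀ * V * A).submatrix e e).map (C : ℤ →+* ℤ[T;T⁻¹]))ᵀ =
      ((T 1 : ℤ[T;T⁻¹]) • (Aᵀ * V * A).map (C : ℤ →+* ℤ[T;T⁻¹]) -
        ((Aᵀ * V * A).map (C : ℤ →+* ℤ[T;T⁻¹]))ᵀ).submatrix e e :=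
    Matrix.ext fun _ _ ↦ rfl
  -- congruence: `t (AᵀVA) − (AᵀVA)ᵀ = Aᵀ (tV − Vᵀ) A` after pushing to `ℤ[t, t⁻¹]`
  have h2 : (T 1 : ℤ[T;T⁻¹]) • (Aᵀ * V * A).map (C : ℤ →+* ℤ[T;T⁻¹]) -
      ((Aᵀ * V * A).map (C : ℤ →+* ℤ[T;T⁻¹]))ᵀ =
      (A.map (C : ℤ →+* ℤ[T;T⁻¹]))ᵀ *
        ((T 1 : ℤ[T;T⁻¹]) • V.map (C : ℤ →+* ℤ[T;T⁻¹]) - (V.map (C : ℤ →+* ℤ[T;T⁻¹]))ᵀ) *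
        A.map (C : ℤ →+* ℤ[T;T⁻¹]) := by
    rw [Matrix.map_mul, Matrix.map_mul, Matrix.transpose_map]
    simp only [Matrix.mul_sub, Matrix.sub_mul, Matrix.mul_smul, Matrix.smul_mul,
      Matrix.transpose_mul, Matrix.transpose_transpose, Matrix.mul_assoc]
  rw [h1, det_submatrix_equiv_self, h2, det_mul, det_mul, det_transpose] at hu
  -- `det A` is a unit of `ℤ[t, t⁻¹]`; divide by its square
  obtain ⟨d, hd⟩ := hA.map (C : ℤ →+* ℤ[T;T⁻¹])
  rw [RingHom.map_det, RingHom.mapMatrix_apply] at hd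
  rw [← hd] at hu
  refine ⟨f, d⁻¹ * d⁻¹ * u, ?_⟩
  calc ((T 1 : ℤ[T;T⁻¹]) • V.map (C : ℤ →+* ℤ[T;T⁻¹]) - (V.map (C : ℤ →+* ℤ[T;T⁻¹]))ᵀ).det
      = (↑d⁻¹ * ↑d) * (↑d⁻¹ * ↑d) *
          ((T 1 : ℤ[T;T⁻¹]) • V.map (C : ℤ →+* ℤ[T;T⁻¹]) - (V.map (C : ℤ →+* ℤ[T;T⁻¹]))ᵀ).det := by
        rw [Units.inv_mul, one_mul, one_mul]
    _ = ↑d⁻¹ * ↑d⁻¹ * (↑d *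
          ((T 1 : ℤ[T;T⁻¹]) • V.map (C : ℤ →+* ℤ[T;T⁻¹]) - (V.map (C : ℤ →+* ℤ[T;T⁻¹]))ᵀ).det *
          ↑d) := by ring
    _ = ↑d⁻¹ * ↑d⁻¹ * (↑u * f * LaurentPolynomial.invert f) := by rw [hu]
    _ = ↑(d⁻¹ * d⁻¹ * u) * f * LaurentPolynomial.invert f := by push_cast; ring

end FoxMilnor

end Literature.Topology.FourManifolds
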